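import Summits.MatrixMultiplication.MatrixMultiplication.Theses.FieldSumsetRank

/-!
# Assembly of route FieldSumsetRank (stmt-MatrixMultiplication-11007)

The assembly item `Assembly` of route `FieldSumsetRank` is the implication

`HostingSuperquadratic → UpperSandwich → ¬ MatrixMultiplication`,

i.e. the superquadratic lower bound for the cost of polynomial hostings of `⟨n,n,n⟩`, together with
the upper sandwich `cost ≤ 2·R(⟨n,n,n⟩) − 1`, refutes `ω(ℂ) = 2`.  This is pure logic on top of the
proved assembly of route BorderRankLowerBound
(`Literature.not_matrixMultiplication_of_superquadratic_rank`): a hosting of cost `≤ 2R − 1 ≤ 2R`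
whose cost is at least `c·n^{2+δ}` gives `R(⟨n,n,n⟩) ≥ (c/2)·n^{2+δ}` for every `n ≥ 1`.
The route file's deciding theorem `closes` has literally this statement; here it is recorded under
the item's name with a self-contained proof.
-/

-- single-conjunct summit (D-0017): the mandated namespace
-- `Summit.MatrixMultiplication.MatrixMultiplication.…` repeats `MatrixMultiplication`
-- (summit = sub-problem), which `linter.dupNamespace` would flag.
set_option linter.dupNamespace false

namespace Summit.MatrixMultiplication.MatrixMultiplication.Theorems

open Summit.MatrixMultiplication.MatrixMultiplication.Theses.FieldSumsetRank

/-- **Assembly of route FieldSumsetRank** (stmt-MatrixMultiplication-11007): the target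
`HostingSuperquadratic` and the support item `UpperSandwich` together refute the summit statement
`MatrixMultiplication` (`ω(ℂ) = 2`).  Proof: for `n ≥ 1` let `R = R(⟨n,n,n⟩)`; `UpperSandwich`
with `r = R` gives a polynomial hosting `(α, β, γ)` of cost `≤ 2R − 1 ≤ 2R`, and
`HostingSuperquadratic` bounds that cost below by `c·n^{2+δ}`, so `(c/2)·n^{2+δ} ≤ R`, which is the
hypothesis of `Literature.not_matrixMultiplication_of_superquadratic_rank`. -/
theorem fieldSumsetRank_assembly_proof :
    Summit.MatrixMultiplication.MatrixMultiplication.Theses.FieldSumsetRank.Assembly := by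
  unfold Summit.MatrixMultiplication.MatrixMultiplication.Theses.FieldSumsetRank.Assembly
  rintro ⟨δ, hδ, c, hc, hX⟩ hU
  refine Literature.not_matrixMultiplication_of_superquadratic_rank ⟨δ, hδ, c / 2, by positivity, ?_⟩
  intro n hn
  obtain ⟨α, β, γ, hhost, hdim⟩ := hU n _ le_rfl
  have h1 := hX n hn α β γ hhost
  have h3 : Module.finrank ℂ ↥(LinearMap.range α * LinearMap.range β)
      ≤ 2 * Literature.Computability.AlgebraicComplexity.tensorRank
        (Literature.Computability.AlgebraicComplexity.matMulTensor ℂ n n n) :=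
    hdim.trans (Nat.sub_le _ _)
  have h2 : (Module.finrank ℂ ↥(LinearMap.range α * LinearMap.range β) : ℝ)
      ≤ 2 * (Literature.Computability.AlgebraicComplexity.tensorRank
        (Literature.Computability.AlgebraicComplexity.matMulTensor ℂ n n n) : ℝ) := by
    exact_mod_cast h3
  calc c / 2 * (n : ℝ) ^ (2 + δ) = (c * (n : ℝ) ^ (2 + δ)) / 2 := by ring
    _ ≤ (Module.finrank ℂ ↥(LinearMap.range α * LinearMap.range β) : ℝ) / 2 := by gcongr
    _ ≤ _ := by linarith

end Summit.MatrixMultiplication.MatrixMultiplication.Theorems
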